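import Mathlib
import HarnessLib
import Literature.MathematicalPhysics.QuantumLattice.FermiRG.BGM2003Sectors
import Summits.HubbardSuperconductivity.HubbardSuperconductivity.Theorems.KLProgrammeH10TwoPointLimitPerturbedNormalAngleLipschitz
import Summits.HubbardSuperconductivity.HubbardSuperconductivity.Theorems.KLProgrammeAbsUmklappClassFibre

/-!
# Route `KLProgramme` — K3 engine (stmt-HubbardSuperconductivity-20437), stub (b) (ℓ)/(I2)–(I3), located item «ABS-UMK-COUNT»:
# the COUNT OF ONE NARROW CLASS — `≤ N · K₀^{L−5} · T_bound`, i.e. the `(L−3)` law for the class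

Cell gate-hubbard-kl, seat p4 g15 (route HOME/prover-p4/UV-REMEASURE-COUNT.md §5).  The class of `card_classFibre_le` (target strings anchored at `ω₁`, pairwise
pair angles of the free legs `≤ Φ₀`, kept triple `a, b, c` within torus distance `2Φ₀` of `θ_{n′,ω_s} + σ`) is projected by zeroing the kept legs; the image
lies in a union over the base label `ω_s` (`N = 2^{n′+1}` values) of products of coordinate sets: singletons at `i₁, s, a, b, c` and the CONE
`{ω : pairAngle(θ_{n′,ω}, θ_{n′,ω_s}) ≤ Φ₀}` (`≤ K₀ = 2(2Φ₀/w_{n′} + 1)` labels) at each of the `L − 5` sliced legs; each fibre has `≤ T_bound` elements: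

* `torusDist_sub_pi_le`, `torusDist_alt_of_pairAngle_le` — torus arithmetic (with `PerturbedFermiCurve.torusDist_add_int_mul_two_pi/le_abs_self`);
* `card_cone_torusDist_le` (`≤ 2Φ₀/w + 1`), `card_cone_pairAngle_le` (`≤ 2(2Φ₀/w + 1)`) — the cone counts (1-D packing of the representatives);
* **`card_narrowClass_le`** — `#class ≤ T_bound · N · K₀^{L−5}`.

Everything is PROVED; no definitions, no named facts. [cite: BenfattoGiulianiMastropietro2003, §7.4 (s1.23)–(s1.25a) p.28 (L33–52)]
-/

noncomputable section

open Real Set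
open Literature.MathematicalPhysics.QuantumLattice Literature.MathematicalPhysics.QuantumLattice.FermiRG
open Literature.MathematicalPhysics.QuantumLattice.FermiRG.BGM2003
open Summit.HubbardSuperconductivity.HubbardSuperconductivity.Theorems.ThinLevelSet
open Summit.HubbardSuperconductivity.HubbardSuperconductivity.Theorems

namespace Summit.HubbardSuperconductivity.HubbardSuperconductivity.Theorems.AbsUmklappCount

set_option linter.dupNamespace false -- summit = problem name (single-conjunct summit), D-0017

/-! ## §1 Torus arithmetic -/

/-- `‖x − π‖_{𝕋¹} ≤ π − ‖x‖_{𝕋¹}`. [folklore] -/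
theorem torusDist_sub_pi_le (x : ℝ) : torusDist (x - π) ≤ π - torusDist x := by
  set d := x - round ((2 * π)⁻¹ * x) * (2 * π) with hd
  set k : ℤ := round ((2 * π)⁻¹ * x) with hk
  have hx : x = d + k * (2 * π) := by rw [hd]; ring
  have hdabs : torusDist x = |d| := torusDist_eq_abs_rep x
  have hdπ : |d| ≤ π := abs_rep_le_pi x
  rw [hdabs]
  rcases le_or_gt 0 d with h | h
  · have e : x - π = (d - π) + k * (2 * π) := by rw [hx]; ring
    rw [e, PerturbedFermiCurve.torusDist_add_int_mul_two_pi]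
    calc torusDist (d - π) ≤ |d - π| := PerturbedFermiCurve.torusDist_le_abs_self _
      _ = π - |d| := by rw [abs_of_nonneg h, abs_of_nonpos (by linarith [(abs_le.1 hdπ).2])]; ring
  · have e : x - π = (d + π) + (k - 1 : ℤ) * (2 * π) := by rw [hx]; push_cast; ring
    rw [e, PerturbedFermiCurve.torusDist_add_int_mul_two_pi]
    calc torusDist (d + π) ≤ |d + π| := PerturbedFermiCurve.torusDist_le_abs_self _
      _ = π - |d| := by rw [abs_of_neg h, abs_of_nonneg (by linarith [(abs_le.1 hdπ).1])]; ring

/-- A small pair angle means: close, or close to the antipode. [folklore] -/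
theorem torusDist_alt_of_pairAngle_le {θ₁ θ₂ Φ₀ : ℝ} (h : pairAngle θ₁ θ₂ ≤ Φ₀) :
    torusDist (θ₁ - θ₂) ≤ Φ₀ ∨ torusDist (θ₁ - (θ₂ + π)) ≤ Φ₀ := by
  rw [pairAngle, min_le_iff] at h
  rcases h with h | h
  · exact Or.inl h
  · right
    rw [show θ₁ - (θ₂ + π) = (θ₁ - θ₂) - π by ring]
    exact (torusDist_sub_pi_le _).trans h

/-! ## §2 Cone counts -/

open Classical in
/-- **The cone count**: at most `2Φ₀/w_n + 1` sector centres of scale `n` lie within torus distance `Φ₀` of a given angle. [folklore] -/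
theorem card_cone_torusDist_le (n : ℕ) (θs Φ₀ : ℝ) (hΦ₀ : 0 ≤ Φ₀) :
    (((Finset.univ : Finset (Fin (sectorCount n))).filter fun x : Fin (sectorCount n) => torusDist (sectorCenter n x - θs) ≤ Φ₀).card : ℝ) ≤
      2 * Φ₀ / sectorWidth n + 1 := by
  set C := (Finset.univ : Finset (Fin (sectorCount n))).filter fun x : Fin (sectorCount n) => torusDist (sectorCenter n x - θs) ≤ Φ₀ with hC
  set rep : Fin (sectorCount n) → ℝ := fun x => sectorCenter n x - θs - round ((2 * π)⁻¹ * (sectorCenter n x - θs)) * (2 * π) with hrep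
  have hsep : ∀ x y : Fin (sectorCount n), x ≠ y → sectorWidth n ≤ |rep x - rep y| := by
    intro x y hxy
    have hne : (x : ℕ) ≠ (y : ℕ) := fun h => hxy (Fin.ext h)
    exact sectorWidth_le_abs_rep_sub_rep n θs x.isLt y.isLt hne
  have hinj : Set.InjOn rep C := by
    intro x _ y _ hxy
    by_contra hne
    have h := hsep x y hne
    rw [hxy, sub_self, abs_zero] at h
    exact absurd h (not_le.2 (sectorWidth_pos n))
  rw [← Finset.card_image_of_injOn hinj]
  refine card_le_of_separated_subset_Icc (sectorWidth_pos n) (a := -Φ₀) (b := Φ₀) (by linarith) _ ?_ ?_ |>.trans (by ring_nf; rfl)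
  · intro r hr
    rw [Finset.mem_image] at hr
    obtain ⟨x, hx, rfl⟩ := hr
    rw [hC, Finset.mem_filter] at hx
    have := abs_le.1 (abs_rep_le_of_torusDist_le hx.2)
    exact ⟨this.1, this.2⟩
  · intro r hr r' hr' hne
    rw [Finset.mem_image] at hr hr'
    obtain ⟨x, -, rfl⟩ := hr
    obtain ⟨y, -, rfl⟩ := hr'
    exact hsep x y fun h => hne (by rw [h])

open Classical in
/-- **The cone count for the pair angle**: at most `2(2Φ₀/w_n + 1)` sector centres have pair angle `≤ Φ₀` with a given centre. [folklore] -/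
theorem card_cone_pairAngle_le (n : ℕ) (θm Φ₀ : ℝ) (hΦ₀ : 0 ≤ Φ₀) :
    (((Finset.univ : Finset (Fin (sectorCount n))).filter fun x : Fin (sectorCount n) => pairAngle (sectorCenter n x) θm ≤ Φ₀).card : ℝ) ≤
      2 * (2 * Φ₀ / sectorWidth n + 1) := by
  set C₁ := (Finset.univ : Finset (Fin (sectorCount n))).filter fun x : Fin (sectorCount n) => torusDist (sectorCenter n x - θm) ≤ Φ₀ with hC₁
  set C₂ := (Finset.univ : Finset (Fin (sectorCount n))).filter fun x : Fin (sectorCount n) => torusDist (sectorCenter n x - (θm + π)) ≤ Φ₀ with hC₂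
  have hsub : ((Finset.univ : Finset (Fin (sectorCount n))).filter fun x : Fin (sectorCount n) => pairAngle (sectorCenter n x) θm ≤ Φ₀) ⊆ C₁ ∪ C₂ := by
    intro x hx
    rw [Finset.mem_filter] at hx
    rw [Finset.mem_union, hC₁, hC₂, Finset.mem_filter, Finset.mem_filter]
    rcases torusDist_alt_of_pairAngle_le hx.2 with h | h
    · exact Or.inl ⟨Finset.mem_univ _, h⟩
    · exact Or.inr ⟨Finset.mem_univ _, h⟩
  have h1 := card_cone_torusDist_le n θm Φ₀ hΦ₀
  have h2 := card_cone_torusDist_le n (θm + π) Φ₀ hΦ₀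
  calc (((Finset.univ : Finset (Fin (sectorCount n))).filter fun x : Fin (sectorCount n) => pairAngle (sectorCenter n x) θm ≤ Φ₀).card : ℝ)
      ≤ ((C₁ ∪ C₂).card : ℝ) := by exact_mod_cast Finset.card_le_card hsub
    _ ≤ (C₁.card : ℝ) + (C₂.card : ℝ) := by exact_mod_cast Finset.card_union_le _ _
    _ ≤ (2 * Φ₀ / sectorWidth n + 1) + (2 * Φ₀ / sectorWidth n + 1) := add_le_add h1 h2
    _ = 2 * (2 * Φ₀ / sectorWidth n + 1) := by ring

/-! ## §3 The count of one narrow class -/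

open Classical in
/-- **The count of one narrow class** (`(L−3)` law for the class): with `T_bound` the fibre bound of `card_classFibre_le`, `N = 2^{n′+1}` and
`K₀ = 2(2Φ₀/w_{n′} + 1)`, the class has at most `T_bound · N · K₀^{L−5}` strings. [cite: BenfattoGiulianiMastropietro2003, §7.4 (s1.23)–(s1.25a) p.28 (L33–52)] -/
theorem card_narrowClass_le {ε : (Fin 2 → ℝ) → ℝ} {μ e₀ : ℝ} {u : ℝ → ℝ → ℝ} (hD : DispersionHyp ε μ e₀ u) {c₃ : ℝ} (hc₃ : 0 < c₃)
    (h73 : ∀ (n ω : ℕ), ω < sectorCount n → ∀ p ∈ sSector u e₀ n ω,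
      ∃ k₁ k₂ : ℝ,
        p = fermiPoint u (sectorCenter n ω) + k₁ • unitNormal u (sectorCenter n ω) 0 +
              k₂ • unitTangent u (sectorCenter n ω) 0 ∧
        |k₁| ≤ c₃ * (4 : ℝ) ^ (-(n : ℤ)) ∧ |k₂| ≤ c₃ * (2 : ℝ) ^ (-(n : ℤ)) ∧
        |fderiv ℝ ε p (unitTangent u (sectorCenter n ω) 0)| ≤ c₃ * (2 : ℝ) ^ (-(n : ℤ)))
    {s₁ Φ cf Af Bf M₁ : ℝ} (hs₁ : 0 < s₁) (hM₁ : 0 ≤ M₁) (hΦ : 0 < Φ) (hcf : 0 < cf) (hcfA : cf ≤ Af) (hBf : 0 ≤ Bf)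
    (hchart : ∀ θs : ℝ, ∃ f f' f'' : ℝ → ℝ, Measurable f ∧
        (∀ φ ∈ Icc (-Φ) Φ,
          f ((fermiPoint u (θs + φ) - fermiPoint u θs) ⬝ᵥ tdir θs) = -((fermiPoint u (θs + φ) - fermiPoint u θs) ⬝ᵥ dir θs)) ∧
        (∀ y ∈ Icc (-(s₁ / 4 * Φ)) (s₁ / 4 * Φ), HasDerivAt f (f' y) y ∧ HasDerivAt f' (f'' y) y ∧
          cf ≤ f'' y ∧ f'' y ≤ Af ∧ |f' y| ≤ Bf) ∧
        (∀ φ ∈ Icc (-Φ) Φ, ∀ φ' ∈ Icc (-Φ) Φ,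
          s₁ / 2 * |φ - φ'| ≤ |(fermiPoint u (θs + φ) - fermiPoint u θs) ⬝ᵥ tdir θs - (fermiPoint u (θs + φ') - fermiPoint u θs) ⬝ᵥ tdir θs| ∧
          |(fermiPoint u (θs + φ) - fermiPoint u θs) ⬝ᵥ tdir θs - (fermiPoint u (θs + φ') - fermiPoint u θs) ⬝ᵥ tdir θs| ≤ M₁ * |φ - φ'|) ∧
        (fermiPoint u (θs + 0) - fermiPoint u θs) ⬝ᵥ tdir θs = 0)
    {n' L : ℕ} (i₁ s a b c : Fin L) (hia : i₁ ≠ a) (hib : i₁ ≠ b) (hic : i₁ ≠ c) (his : i₁ ≠ s)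
    (hsa : s ≠ a) (hsb : s ≠ b) (hsc : s ≠ c) (hab : a ≠ b) (hac : a ≠ c) (hbc : b ≠ c)
    (ω₁ : ℕ) (R : Fin 2 → ℝ) {Φ₀ : ℝ} (hΦ₀ : 0 ≤ Φ₀) (h2Φ₀ : 2 * Φ₀ ≤ Φ) (σ : ℝ)
    (hreg : 6 * (M₁ * (2 * Φ₀)) + 3 * (L * (4 * c₃ * (2 : ℝ) ^ (-(n' : ℤ)))) + 2 * (s₁ / 2 * sectorWidth n') ≤ s₁ / 4 * Φ) :
    ((((Finset.univ : Finset (Fin L → Fin (sectorCount n'))).filter fun ω =>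
        (ω i₁ : ℕ) = ω₁ ∧ (∀ i j : Fin L, i ≠ i₁ → j ≠ i₁ → pairAngle (sectorCenter n' (ω i)) (sectorCenter n' (ω j)) ≤ Φ₀) ∧
        (∀ x ∈ ({a, b, c} : Finset (Fin L)), torusDist (sectorCenter n' (ω x) - (sectorCenter n' (ω s) + σ)) ≤ 2 * Φ₀) ∧
        ∃ k : Fin L → (Fin 2 → ℝ), (∀ i, k i ∈ sSector u e₀ n' (ω i : ℕ)) ∧ ∑ i, k i = R).card : ℝ)) ≤
      (2 * (L * (4 * c₃ * (2 : ℝ) ^ (-(n' : ℤ)))) / (s₁ / 2 * sectorWidth n') + 1) *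
        (960 * Af * (2 * (L * (4 * c₃ * (2 : ℝ) ^ (-(n' : ℤ))) + Bf * (L * (4 * c₃ * (2 : ℝ) ^ (-(n' : ℤ))))) +
          (4 * Bf + 1) * (s₁ / 2 * sectorWidth n')) / cf ^ 2 / (s₁ / 2 * sectorWidth n') ^ 2) *
      ((sectorCount n' : ℝ) * (2 * (2 * Φ₀ / sectorWidth n' + 1)) ^ (L - 5)) := by
  set z : Fin (sectorCount n') := ⟨0, sectorCount_pos n'⟩ with hz
  set upd : (Fin L → Fin (sectorCount n')) → (Fin L → Fin (sectorCount n')) :=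
    fun ω => Function.update (Function.update (Function.update ω a z) b z) c z with hupd
  set Cl := (Finset.univ : Finset (Fin L → Fin (sectorCount n'))).filter fun ω =>
        (ω i₁ : ℕ) = ω₁ ∧ (∀ i j : Fin L, i ≠ i₁ → j ≠ i₁ → pairAngle (sectorCenter n' (ω i)) (sectorCenter n' (ω j)) ≤ Φ₀) ∧
        (∀ x ∈ ({a, b, c} : Finset (Fin L)), torusDist (sectorCenter n' (ω x) - (sectorCenter n' (ω s) + σ)) ≤ 2 * Φ₀) ∧
        ∃ k : Fin L → (Fin 2 → ℝ), (∀ i, k i ∈ sSector u e₀ n' (ω i : ℕ)) ∧ ∑ i, k i = R with hCl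
  set Tb : ℝ := (2 * (L * (4 * c₃ * (2 : ℝ) ^ (-(n' : ℤ)))) / (s₁ / 2 * sectorWidth n') + 1) *
        (960 * Af * (2 * (L * (4 * c₃ * (2 : ℝ) ^ (-(n' : ℤ))) + Bf * (L * (4 * c₃ * (2 : ℝ) ^ (-(n' : ℤ))))) +
          (4 * Bf + 1) * (s₁ / 2 * sectorWidth n')) / cf ^ 2 / (s₁ / 2 * sectorWidth n') ^ 2) with hTb
  have hw := sectorWidth_pos n'
  have hAf : 0 < Af := hcf.trans_le hcfA
  have hTb0 : 0 ≤ Tb := by rw [hTb]; positivity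
  set K₀ : ℝ := 2 * (2 * Φ₀ / sectorWidth n' + 1) with hK₀
  have hK₀0 : 0 ≤ K₀ := by rw [hK₀]; positivity
  -- values of the projection
  have hupd_a : ∀ ω, upd ω a = z := fun ω => by
    rw [hupd]; simp only; rw [Function.update_of_ne hac, Function.update_of_ne hab, Function.update_self]
  have hupd_b : ∀ ω, upd ω b = z := fun ω => by
    rw [hupd]; simp only; rw [Function.update_of_ne hbc, Function.update_self]
  have hupd_c : ∀ ω, upd ω c = z := fun ω => by
    rw [hupd]; simp only; rw [Function.update_self]
  have hupd_of_ne : ∀ ω i, i ≠ a → i ≠ b → i ≠ c → upd ω i = ω i := fun ω i hia' hib' hic' => by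
    rw [hupd]; simp only; rw [Function.update_of_ne hic', Function.update_of_ne hib', Function.update_of_ne hia']
  -- the coordinate sets
  set cone : Fin (sectorCount n') → Finset (Fin (sectorCount n')) := fun m =>
    (Finset.univ : Finset (Fin (sectorCount n'))).filter fun x : Fin (sectorCount n') =>
      pairAngle (sectorCenter n' x) (sectorCenter n' m) ≤ Φ₀ with hcone
  set F₁ : Finset (Fin (sectorCount n')) := (Finset.univ : Finset (Fin (sectorCount n'))).filter fun x : Fin (sectorCount n') =>
      (x : ℕ) = ω₁ with hF₁
  set B : Fin (sectorCount n') → Fin L → Finset (Fin (sectorCount n')) := fun m i =>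
    if i = a ∨ i = b ∨ i = c then {z} else if i = s then {m} else if i = i₁ then F₁ else cone m with hB
  set P := (Finset.univ : Finset (Fin L → Fin (sectorCount n'))).filter fun ρ => ∀ i, ρ i ∈ B (ρ s) i with hP
  -- the class projects into `P`
  have Hf : ∀ ω ∈ Cl, upd ω ∈ P := by
    intro ω hω
    rw [hCl, Finset.mem_filter] at hω
    obtain ⟨-, hω₁, hnar, -, -⟩ := hω
    rw [hP, Finset.mem_filter]
    refine ⟨Finset.mem_univ _, fun i => ?_⟩
    have hs' : upd ω s = ω s := hupd_of_ne ω s hsa hsb hsc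
    rw [hs', hB]; simp only
    by_cases hiabc : i = a ∨ i = b ∨ i = c
    · rw [if_pos hiabc, Finset.mem_singleton]
      rcases hiabc with h | h | h
      · rw [h]; exact hupd_a ω
      · rw [h]; exact hupd_b ω
      · rw [h]; exact hupd_c ω
    rw [if_neg hiabc]
    have hiabc' : i ≠ a ∧ i ≠ b ∧ i ≠ c := by
      refine ⟨fun h => hiabc (Or.inl h), fun h => hiabc (Or.inr (Or.inl h)), fun h => hiabc (Or.inr (Or.inr h))⟩
    rw [hupd_of_ne ω i hiabc'.1 hiabc'.2.1 hiabc'.2.2]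
    by_cases his' : i = s
    · rw [if_pos his', Finset.mem_singleton, his']
    rw [if_neg his']
    by_cases hii : i = i₁
    · rw [if_pos hii, hF₁, Finset.mem_filter, hii]; exact ⟨Finset.mem_univ _, hω₁⟩
    rw [if_neg hii, hcone, Finset.mem_filter]
    exact ⟨Finset.mem_univ _, hnar i s hii his.symm⟩
  -- every fibre over `P` has at most `⌊Tb⌋₊` elements
  have hn : ∀ ρ ∈ P, (Cl.filter fun ω => upd ω = ρ).card ≤ ⌊Tb⌋₊ := by
    intro ρ _
    apply Nat.le_floor
    have h := card_classFibre_le hD hc₃ h73 hs₁ hM₁ hΦ hcf hcfA hBf hchart i₁ s a b c hsa hsb hsc hab hac hbc ω₁ R hΦ₀ h2Φ₀ σ hreg ρ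
    rw [hTb]
    exact h
  have h1 : Cl.card ≤ ⌊Tb⌋₊ * P.card := Finset.card_le_mul_card_image_of_maps_to Hf ⌊Tb⌋₊ hn
  -- `P` lies in a union of products
  have hPsub : P ⊆ (Finset.univ : Finset (Fin (sectorCount n'))).biUnion fun m => Fintype.piFinset (B m) := by
    intro ρ hρ
    rw [hP, Finset.mem_filter] at hρ
    rw [Finset.mem_biUnion]
    exact ⟨ρ s, Finset.mem_univ _, Fintype.mem_piFinset.2 hρ.2⟩
  -- the five distinguished legs
  set A : Finset (Fin L) := {i₁, s, a, b, c} with hA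
  have hAcard : A.card = 5 := by
    rw [hA, Finset.card_insert_of_notMem (by simp [his, hia, hib, hic]), Finset.card_insert_of_notMem (by simp [hsa, hsb, hsc]),
      Finset.card_insert_of_notMem (by simp [hab, hac]), Finset.card_insert_of_notMem (by simp [hbc]), Finset.card_singleton]
  have hAc : Aᶜ.card = L - 5 := by rw [Finset.card_compl, hAcard, Fintype.card_fin]
  have hmemAc : ∀ i ∈ Aᶜ, i ≠ i₁ ∧ i ≠ s ∧ i ≠ a ∧ i ≠ b ∧ i ≠ c := by
    intro i hi
    rw [Finset.mem_compl, hA] at hi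
    simpa [not_or] using hi
  -- the product of the coordinate-set sizes
  have hprod : ∀ m, ((Fintype.piFinset (B m)).card : ℝ) ≤ K₀ ^ (L - 5) := by
    intro m
    rw [Fintype.card_piFinset, ← Finset.prod_mul_prod_compl A]
    have hA1 : ∏ i ∈ A, (B m i).card ≤ 1 := by
      have hF₁card : F₁.card ≤ 1 := Finset.card_le_one.2 fun x hx y hy => by
        rw [hF₁, Finset.mem_filter] at hx hy; exact Fin.ext (hx.2.trans hy.2.symm)
      have hle : ∀ i ∈ A, (B m i).card ≤ 1 := by
        intro i hi
        rw [hA] at hi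
        simp only [Finset.mem_insert, Finset.mem_singleton] at hi
        rw [hB]; simp only
        rcases hi with rfl | rfl | rfl | rfl | rfl
        · rw [if_neg (by rw [not_or, not_or]; exact ⟨hia, hib, hic⟩), if_neg his, if_pos rfl]; exact hF₁card
        · rw [if_neg (by rw [not_or, not_or]; exact ⟨hsa, hsb, hsc⟩), if_pos rfl, Finset.card_singleton]
        · rw [if_pos (Or.inl rfl), Finset.card_singleton]
        · rw [if_pos (Or.inr (Or.inl rfl)), Finset.card_singleton]
        · rw [if_pos (Or.inr (Or.inr rfl)), Finset.card_singleton]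
      have h := Finset.prod_le_pow_card A (fun i => (B m i).card) 1 hle
      rwa [one_pow] at h
    have hA2 : ∏ i ∈ Aᶜ, (B m i).card = (cone m).card ^ (L - 5) := by
      rw [← hAc, ← Finset.prod_const]
      refine Finset.prod_congr rfl fun i hi => ?_
      obtain ⟨h1, h2, h3, h4, h5⟩ := hmemAc i hi
      rw [hB]; simp only
      rw [if_neg (by rw [not_or, not_or]; exact ⟨h3, h4, h5⟩), if_neg h2, if_neg h1]
    have hcone_le : ((cone m).card : ℝ) ≤ K₀ := by
      rw [hcone, hK₀]; exact card_cone_pairAngle_le n' (sectorCenter n' m) Φ₀ hΦ₀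
    have hcast : (((∏ i ∈ A, (B m i).card) * ∏ i ∈ Aᶜ, (B m i).card : ℕ) : ℝ) ≤ 1 * K₀ ^ (L - 5) := by
      rw [hA2]; push_cast
      exact mul_le_mul (by exact_mod_cast hA1) (pow_le_pow_left₀ (Nat.cast_nonneg _) hcone_le _) (by positivity) zero_le_one
    rw [one_mul] at hcast
    exact hcast
  have hPcard : (P.card : ℝ) ≤ (sectorCount n' : ℝ) * K₀ ^ (L - 5) := by
    calc (P.card : ℝ) ≤ (((Finset.univ : Finset (Fin (sectorCount n'))).biUnion fun m => Fintype.piFinset (B m)).card : ℝ) := by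
          exact_mod_cast Finset.card_le_card hPsub
      _ ≤ ∑ m : Fin (sectorCount n'), ((Fintype.piFinset (B m)).card : ℝ) := by
          exact_mod_cast Finset.card_biUnion_le
      _ ≤ ∑ _m : Fin (sectorCount n'), K₀ ^ (L - 5) := Finset.sum_le_sum fun m _ => hprod m
      _ = (sectorCount n' : ℝ) * K₀ ^ (L - 5) := by
          rw [Finset.sum_const, nsmul_eq_mul, Finset.card_univ, Fintype.card_fin]
  -- assemble
  have h2 : (Cl.card : ℝ) ≤ (⌊Tb⌋₊ : ℝ) * (P.card : ℝ) := by exact_mod_cast h1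
  have h3 : (⌊Tb⌋₊ : ℝ) ≤ Tb := Nat.floor_le hTb0
  calc (Cl.card : ℝ) ≤ (⌊Tb⌋₊ : ℝ) * (P.card : ℝ) := h2
    _ ≤ Tb * ((sectorCount n' : ℝ) * K₀ ^ (L - 5)) := mul_le_mul h3 hPcard (Nat.cast_nonneg _) hTb0

end Summit.HubbardSuperconductivity.HubbardSuperconductivity.Theorems.AbsUmklappCount

end
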